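import Literature.Analysis.FluidPDE.NSSereginMildStabilityCore
import Literature.Analysis.FluidPDE.LocalLeraySlabViscosityScaling
import Literature.Analysis.FluidPDE.LocalLerayRescaling
import HarnessLib

/-!
# Stability of a singular point at the final time (`lemarieRieusset_singular_point_stability`)
from Thm. 14.4, the pressure decay estimate and the local pressure bound — general viscosity

Analysis/FluidPDE proof file (no new definitions, no named facts), top of the decomposition of
the named fact `Literature.Analysis.FluidPDE.lemarieRieusset_singular_point_stability`
(`NSSereginMildFacts.lean`; Lemarié-Rieusset, *The Navier–Stokes Problem in the 21st Century*,
proof of Thm. 15.5, PDF pp. 571–573 of the held scan). The unit-viscosity statement is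
`singular_point_stability_unit` (`NSSereginMildStabilityCore.lean`, from
`lemarieRieusset_epsilon_regularity`, `seregin_sverak_pressure_decay`,
`kangMiuraTsai_local_pressure_bound`); here the general viscosity `ν > 0` is reduced to `ν = 1`
by the pure time rescaling `w(s, y) = ν⁻¹ v(s/ν, y)`, `q(s, y) = ν⁻² π(s/ν, y)` (a unit-viscosity
local Leray solution on the slab `(0, νT) × ℝ³`, `IsLocalLeraySolutionOn.toUnitViscosity` of
`LocalLeraySlabViscosityScaling.lean`): the
uniformly local bounds, the `L²_loc` convergence and the boundedness of the limit on a backward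
cylinder transform by the change of variables `t = s/ν` (constants multiplied by powers of `ν`;
the cylinder `Q_{r₀}(T, x₀)` contains the image of `Q_{r₀ min(1,√ν)}(νT, x₀)`), and a bound for
`w_n` on `Q_{r₁}(νT, x₀)` is a bound for `v_n = ν w_n(ν ·, ·)` on `Q_{r₁/max(1,√ν)}(T, x₀)`.

Main result: `lemarieRieusset_singular_point_stability_of_facts :
  lemarieRieusset_epsilon_regularity → seregin_sverak_pressure_decay →
  kangMiuraTsai_local_pressure_bound → lemarieRieusset_singular_point_stability`.

State of the DAG below `lemarieRieusset_singular_point_stability` after this file: proved modulo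
Lemarié-Rieusset's Thm. 14.4 (`lemarieRieusset_epsilon_regularity`, itself reduced in
`CKNEpsilonRegularityAssembly.lean`), the pressure decay estimate
(`seregin_sverak_pressure_decay`, Seregin–Šverák 2009 (as13): Calderón–Zygmund + harmonic sup
estimate) and the local pressure bound of slab local Leray solutions
(`kangMiuraTsai_local_pressure_bound`, Kang–Miura–Tsai 2021 Lemma 3.4: the pressure decomposition).
Nothing accepted is restated; no statement is changed.

## References

* P. G. Lemarié-Rieusset, *The Navier–Stokes Problem in the 21st Century* (2016; held scan =
  2nd ed., doi:10.1201/9781003042594): proof of Thm. 15.5, PDF pp. 570–573; Thm. 14.4 (p. 505).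
* W. Rusin, V. Šverák, J. Funct. Anal. 260 (2011) = arXiv:0911.0500, §1 p. 3 (unit viscosity),
  Lemma 2.1.
-/

noncomputable section

open MeasureTheory TopologicalSpace Set Function Filter Metric Module
open _root_.Topology
open scoped ENNReal NNReal RealInnerProductSpace

namespace Literature.Analysis.FluidPDE

/-! ### The time rescaling `t = s/ν` on cylinders at the final time -/

/-- The cylinder `Q_{r min(1,√ν)}(νT, x₀)` is mapped by `(s, y) ↦ (s/ν, y)` into `Q_r(T, x₀)`
(`r ≥ 0`, `ν > 0`). [folklore] -/
theorem parabolicCylinder_subset_preimage_time_affine {ν r T : ℝ} (hν : 0 < ν) (hr : 0 ≤ r)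
    (x₀ : EuclideanSpace ℝ (Fin 3)) :
    parabolicCylinder (r * min 1 (Real.sqrt ν)) ((ν * T : ℝ), x₀) ⊆
      stAffine ν⁻¹ 1 0 (0 : EuclideanSpace ℝ (Fin 3)) ⁻¹' parabolicCylinder r ((T : ℝ), x₀) := by
  rintro ⟨s, y⟩ hw
  rw [mem_parabolicCylinder] at hw
  obtain ⟨⟨h1, h2⟩, h3⟩ := hw
  dsimp only at h1 h2 h3
  rw [mem_preimage, stAffine_apply, mem_parabolicCylinder]
  dsimp only
  have hm0 : 0 ≤ min 1 (Real.sqrt ν) := le_min zero_le_one (Real.sqrt_nonneg ν)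
  have hm1 : min 1 (Real.sqrt ν) ≤ 1 := min_le_left _ _
  have hmsq : (min 1 (Real.sqrt ν)) ^ 2 ≤ ν := by
    calc (min 1 (Real.sqrt ν)) ^ 2 ≤ (Real.sqrt ν) ^ 2 := pow_le_pow_left₀ hm0 (min_le_right _ _) 2
      _ = ν := Real.sq_sqrt hν.le
  have hr2 : (r * min 1 (Real.sqrt ν)) ^ 2 ≤ ν * r ^ 2 := by
    rw [mul_pow]; nlinarith [sq_nonneg r]
  refine ⟨⟨?_, ?_⟩, ?_⟩
  · -- `T - r² < ν⁻¹ s`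
    have h4 : ν * T - ν * r ^ 2 < s := by linarith
    have h5 : ν * (T - r ^ 2) < ν * (ν⁻¹ * s) := by
      rw [mul_inv_cancel_left₀ hν.ne']; linarith
    linarith [lt_of_mul_lt_mul_left h5 hν.le]
  · have h5 : ν * (ν⁻¹ * s) < ν * T := by rw [mul_inv_cancel_left₀ hν.ne']; exact h2
    linarith [lt_of_mul_lt_mul_left h5 hν.le]
  · rw [zero_add, one_smul]
    calc dist y x₀ < r * min 1 (Real.sqrt ν) := h3
      _ ≤ r * 1 := mul_le_mul_of_nonneg_left hm1 hr
      _ = r := mul_one r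

/-- The cylinder `Q_{r / max(1,√ν)}(T, x₀)` is mapped by `(t, x) ↦ (ν t, x)` into `Q_r(νT, x₀)`
(`r ≥ 0`, `ν > 0`). [folklore] -/
theorem parabolicCylinder_subset_preimage_time_affine' {ν r T : ℝ} (hν : 0 < ν) (hr : 0 ≤ r)
    (x₀ : EuclideanSpace ℝ (Fin 3)) :
    parabolicCylinder (r / max 1 (Real.sqrt ν)) ((T : ℝ), x₀) ⊆
      stAffine ν 1 0 (0 : EuclideanSpace ℝ (Fin 3)) ⁻¹' parabolicCylinder r ((ν * T : ℝ), x₀) := by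
  rintro ⟨t, x⟩ hw
  rw [mem_parabolicCylinder] at hw
  obtain ⟨⟨h1, h2⟩, h3⟩ := hw
  dsimp only at h1 h2 h3
  rw [mem_preimage, stAffine_apply, mem_parabolicCylinder]
  dsimp only
  have hm1 : 1 ≤ max 1 (Real.sqrt ν) := le_max_left _ _
  have hm0 : 0 < max 1 (Real.sqrt ν) := lt_of_lt_of_le one_pos hm1
  have hmsq : ν ≤ (max 1 (Real.sqrt ν)) ^ 2 := by
    calc ν = (Real.sqrt ν) ^ 2 := (Real.sq_sqrt hν.le).symm
      _ ≤ (max 1 (Real.sqrt ν)) ^ 2 := pow_le_pow_left₀ (Real.sqrt_nonneg ν) (le_max_right _ _) 2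
  have hr2 : ν * (r / max 1 (Real.sqrt ν)) ^ 2 ≤ r ^ 2 := by
    rw [div_pow, mul_div_assoc']
    rw [div_le_iff₀ (by positivity)]
    nlinarith [sq_nonneg r]
  refine ⟨⟨?_, ?_⟩, ?_⟩
  · nlinarith
  · nlinarith
  · rw [zero_add, one_smul]
    calc dist x x₀ < r / max 1 (Real.sqrt ν) := h3
      _ ≤ r / 1 := div_le_div_of_nonneg_left hr one_pos hm1
      _ = r := div_one r

/-- The time-rescaled field `ν⁻¹ v(s/ν, y)` uncurried is `ν⁻¹ • (uncurry v ∘ Φ)`,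
`Φ(s, y) = (s/ν, y)`. [folklore] -/
theorem uncurry_smul_stPull_time {F : Type*} [NormedAddCommGroup F] [NormedSpace ℝ F] (ν : ℝ)
    (v : ℝ → EuclideanSpace ℝ (Fin 3) → F) :
    uncurry (ν⁻¹ • stPull ν⁻¹ 1 0 (0 : EuclideanSpace ℝ (Fin 3)) v) =
      ν⁻¹ • (uncurry v ∘ stAffine ν⁻¹ 1 0 (0 : EuclideanSpace ℝ (Fin 3))) := by
  funext z
  rcases z with ⟨s, y⟩
  simp [uncurry, stPull_apply, stAffine_apply]

/-- Inverting the time rescaling: `v(t, x) = ν w(ν t, x)` for `w(s, y) = ν⁻¹ v(s/ν, y)`, i.e.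
`uncurry v = ν • (uncurry w ∘ Ψ)`, `Ψ(t, x) = (ν t, x)` (`ν ≠ 0`). [folklore] -/
theorem uncurry_eq_smul_uncurry_stPull_comp {F : Type*} [NormedAddCommGroup F] [NormedSpace ℝ F]
    {ν : ℝ} (hν : ν ≠ 0) (v : ℝ → EuclideanSpace ℝ (Fin 3) → F) :
    uncurry v = ν • (uncurry (ν⁻¹ • stPull ν⁻¹ 1 0 (0 : EuclideanSpace ℝ (Fin 3)) v) ∘
      stAffine ν 1 0 (0 : EuclideanSpace ℝ (Fin 3))) := by
  funext z
  rcases z with ⟨t, x⟩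
  simp [uncurry, stPull_apply, stAffine_apply, smul_smul, hν]

/-! ### The general-viscosity statement -/

/-- **Lemarié-Rieusset's stability of a singular point at the final time
(`lemarieRieusset_singular_point_stability`) from Thm. 14.4 (`lemarieRieusset_epsilon_regularity`),
the pressure decay estimate (`seregin_sverak_pressure_decay`) and the local pressure bound of slab
local Leray solutions (`kangMiuraTsai_local_pressure_bound`)** (Lemarié-Rieusset 2016, proof of
Thm. 15.5, PDF pp. 571–573, (15.5)–(15.6) with Thm. 14.4). The unit-viscosity case is
`singular_point_stability_unit`; a general `ν > 0` is reduced to it by the time rescaling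
`w(s, y) = ν⁻¹ v(s/ν, y)` (module docstring). [cite: LemarieRieusset2016, proof of Thm. 15.5, PDF pp. 571–573 (15.5)–(15.6) with Thm. 14.4] -/
theorem lemarieRieusset_singular_point_stability_of_facts (hε : lemarieRieusset_epsilon_regularity)
    (hPD : seregin_sverak_pressure_decay) (hKP : kangMiuraTsai_local_pressure_bound) :
    lemarieRieusset_singular_point_stability := by
  intro ν T hν hT C a v π aL vL πL hv hvL hC hG hconv x₀ hreg
  -- the time rescaling `Φ(s, y) = (s/ν, y)`
  have hβ : (0 : ℝ) < ν⁻¹ := inv_pos.2 hν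
  have hTν : ν⁻¹ * (ν * T) = T := inv_mul_cancel_left₀ hν.ne' T
  set w : ℕ → ℝ → EuclideanSpace ℝ (Fin 3) → EuclideanSpace ℝ (Fin 3) :=
    fun n => ν⁻¹ • stPull ν⁻¹ 1 0 (0 : EuclideanSpace ℝ (Fin 3)) (v n) with hw
  set q : ℕ → ℝ → EuclideanSpace ℝ (Fin 3) → ℝ :=
    fun n => (ν⁻¹) ^ 2 • stPull ν⁻¹ 1 0 (0 : EuclideanSpace ℝ (Fin 3)) (π n) with hq
  set wL : ℝ → EuclideanSpace ℝ (Fin 3) → EuclideanSpace ℝ (Fin 3) :=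
    ν⁻¹ • stPull ν⁻¹ 1 0 (0 : EuclideanSpace ℝ (Fin 3)) vL with hwL
  set qL : ℝ → EuclideanSpace ℝ (Fin 3) → ℝ :=
    (ν⁻¹) ^ 2 • stPull ν⁻¹ 1 0 (0 : EuclideanSpace ℝ (Fin 3)) πL with hqL
  have hw' : ∀ n, IsLocalLeraySolutionOn (ν * T) 1 (ν⁻¹ • a n) (w n) (q n) := fun n => by
    simpa only [hw, hq, smul_stPull_eq_timeRescale, smul_stPull_eq_timeRescale_pressure] using
      (hv n).toUnitViscosity hν
  have hwL' : IsLocalLeraySolutionOn (ν * T) 1 (ν⁻¹ • aL) wL qL := by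
    simpa only [hwL, hqL, smul_stPull_eq_timeRescale, smul_stPull_eq_timeRescale_pressure] using
      hvL.toUnitViscosity hν
  have hpreT : stPreimage ν⁻¹ 1 0 (0 : EuclideanSpace ℝ (Fin 3))
      (slab (EuclideanSpace ℝ (Fin 3)) (Ioo 0 T) isOpen_Ioo) =
        slab (EuclideanSpace ℝ (Fin 3)) (Ioo 0 (ν * T)) isOpen_Ioo := by
    have h1 := stPreimage_slab_Ioo hβ (ν * T)
    rwa [hTν] at h1
  -- pointwise form of the rescaled fields
  have e_sq : ∀ (u : ℝ → EuclideanSpace ℝ (Fin 3) → EuclideanSpace ℝ (Fin 3)) (s : ℝ)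
      (y : EuclideanSpace ℝ (Fin 3)),
      ‖(ν⁻¹ • stPull ν⁻¹ 1 0 (0 : EuclideanSpace ℝ (Fin 3)) u) s y‖ₑ ^ 2 =
        ‖ν⁻¹‖ₑ ^ 2 * ‖u (0 + ν⁻¹ * s) y‖ₑ ^ 2 := by
    intro u s y
    simp only [smul_stPull_apply, enorm_smul, mul_pow, one_smul, zero_add]
  -- the constants of the rescaled bounds
  set c₁ : ℝ≥0∞ := ‖ν⁻¹‖ₑ ^ 2 * C with hc₁
  set c₂ : ℝ≥0∞ := ENNReal.ofReal ((ν⁻¹ * 1) ^ 2) *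
    ENNReal.ofReal (ν⁻¹ * (1 : ℝ) ^ finrank ℝ (EuclideanSpace ℝ (Fin 3)))⁻¹ * C with hc₂
  have hc₁top : c₁ ≠ ∞ := ENNReal.mul_ne_top (ENNReal.pow_ne_top enorm_ne_top) ENNReal.coe_ne_top
  have hc₂top : c₂ ≠ ∞ := ENNReal.mul_ne_top
    (ENNReal.mul_ne_top ENNReal.ofReal_ne_top ENNReal.ofReal_ne_top) ENNReal.coe_ne_top
  set C' : ℝ≥0 := (c₁ + c₂).toNNReal with hC'
  have hC'coe : ((C' : ℝ≥0) : ℝ≥0∞) = c₁ + c₂ :=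
    ENNReal.coe_toNNReal (ENNReal.add_ne_top.2 ⟨hc₁top, hc₂top⟩)
  have hc₁C' : c₁ ≤ C' := by rw [hC'coe]; exact le_self_add
  have hc₂C' : c₂ ≤ C' := by rw [hC'coe]; exact le_add_self
  -- uniformly local energy of the rescaled fields
  have hCw : ∀ n, ∀ᵐ s ∂(volume.restrict (Ioo 0 (ν * T))), ∀ x₁ : EuclideanSpace ℝ (Fin 3),
      ∫⁻ y in ball x₁ 1, ‖w n s y‖ₑ ^ 2 ≤ C' := by
    intro n
    have h1 : ∀ᵐ t ∂(volume.restrict (Ioo (0 + ν⁻¹ * 0) (0 + ν⁻¹ * (ν * T)))),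
        ∀ x₁ : EuclideanSpace ℝ (Fin 3), ∫⁻ x in ball x₁ 1, ‖v n t x‖ₑ ^ 2 ≤ C := by
      rw [mul_zero, add_zero, zero_add, hTν]; exact hC n
    filter_upwards [ae_restrict_Ioo_comp_time_affine hβ 0 0 (ν * T) h1] with s hs x₁
    simp_rw [hw, e_sq]
    rw [lintegral_const_mul' _ _ (ENNReal.pow_ne_top enorm_ne_top)]
    exact (mul_le_mul' le_rfl (hs x₁)).trans hc₁C'
  -- uniformly local gradients of the rescaled fields
  have hGw : ∀ n, ∃ G : ℝ → EuclideanSpace ℝ (Fin 3) →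
      EuclideanSpace ℝ (Fin 3) →L[ℝ] EuclideanSpace ℝ (Fin 3),
      HasWeakSpatialGradientOn
          (slab (EuclideanSpace ℝ (Fin 3)) (Ioo 0 (ν * T)) isOpen_Ioo) (w n) G ∧
        ∀ x₁ : EuclideanSpace ℝ (Fin 3), ∫⁻ z in Ioo 0 (ν * T) ×ˢ ball x₁ 1,
          ENNReal.ofReal (frobeniusNormSq (G z.1 z.2)) ≤ C' := by
    intro n
    obtain ⟨G, hGn, hGb⟩ := hG n
    refine ⟨(ν⁻¹ * 1) • stPull ν⁻¹ 1 0 (0 : EuclideanSpace ℝ (Fin 3)) G, ?_, fun x₁ => ?_⟩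
    · have h1 := hGn.stRescale ν⁻¹ hβ one_pos 0 (0 : EuclideanSpace ℝ (Fin 3))
      rw [hpreT] at h1
      exact h1
    · have hpre :=
        stAffine_preimage_Ioo_prod_ball hβ one_pos (0 : EuclideanSpace ℝ (Fin 3)) (ν * T) 1 x₁
      rw [zero_add, one_smul, one_mul] at hpre
      rw [← hpre, setLIntegral_frobeniusNormSq_stRescale hβ one_pos 0 (0 : EuclideanSpace ℝ (Fin 3))
        (ν⁻¹ * 1) G, hTν]
      exact (mul_le_mul' le_rfl (hGb x₁)).trans hc₂C'
  -- `L²_loc` convergence of the rescaled fields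
  have hconvw : ∀ R : ℝ, 0 < R →
      Tendsto (fun n => ∫⁻ z in Ioo 0 (ν * T) ×ˢ ball (0 : EuclideanSpace ℝ (Fin 3)) R,
        ‖w n z.1 z.2 - wL z.1 z.2‖ₑ ^ 2) atTop (𝓝 0) := by
    intro R hR
    have hpre :=
      stAffine_preimage_Ioo_prod_ball hβ one_pos (0 : EuclideanSpace ℝ (Fin 3)) (ν * T) R 0
    rw [smul_zero, add_zero, one_mul] at hpre
    have key : ∀ n, ∫⁻ z in Ioo 0 (ν * T) ×ˢ ball (0 : EuclideanSpace ℝ (Fin 3)) R,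
        ‖w n z.1 z.2 - wL z.1 z.2‖ₑ ^ 2 =
          ‖ν⁻¹‖ₑ ^ 2 * ENNReal.ofReal (ν⁻¹ * (1 : ℝ) ^ finrank ℝ (EuclideanSpace ℝ (Fin 3)))⁻¹ *
            ∫⁻ z in Ioo 0 T ×ˢ ball (0 : EuclideanSpace ℝ (Fin 3)) R,
              ‖v n z.1 z.2 - vL z.1 z.2‖ₑ ^ 2 := by
      intro n
      have e1 : ∀ z : ℝ × EuclideanSpace ℝ (Fin 3), ‖w n z.1 z.2 - wL z.1 z.2‖ₑ ^ 2 =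
          ‖(ν⁻¹ • stPull ν⁻¹ 1 0 (0 : EuclideanSpace ℝ (Fin 3)) (fun t x => v n t x - vL t x))
            z.1 z.2‖ₑ ^ 2 := by
        intro z
        simp only [hw, hwL, smul_stPull_apply, smul_sub]
      simp_rw [e1]
      rw [← hpre, setLIntegral_enorm_pow_stRescale hβ one_pos 0 (0 : EuclideanSpace ℝ (Fin 3)) ν⁻¹
        (fun t x => v n t x - vL t x) _ 2, hTν]
    simp_rw [key]
    have hfin : ‖ν⁻¹‖ₑ ^ 2 * ENNReal.ofReal (ν⁻¹ * (1 : ℝ) ^ finrank ℝ (EuclideanSpace ℝ (Fin 3)))⁻¹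
        ≠ ∞ := ENNReal.mul_ne_top (ENNReal.pow_ne_top enorm_ne_top) ENNReal.ofReal_ne_top
    have h1 := ENNReal.Tendsto.const_mul (hconv R hR) (Or.inr hfin)
    rwa [mul_zero] at h1
  -- boundedness of the rescaled limit on `Q_{r₀ min(1,√ν)}(νT, x₀)`
  have hregw : ∃ r₀ : ℝ, 0 < r₀ ∧ r₀ ^ 2 < ν * T ∧
      eLpNorm (uncurry wL) ∞ (volume.restrict (parabolicCylinder r₀ ((ν * T : ℝ), x₀))) < ∞ := by
    obtain ⟨r₀, hr₀, hr₀T, hbdd⟩ := hreg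
    have hm0 : 0 < min 1 (Real.sqrt ν) := lt_min one_pos (Real.sqrt_pos.2 hν)
    have hmsq : (min 1 (Real.sqrt ν)) ^ 2 ≤ ν := by
      calc (min 1 (Real.sqrt ν)) ^ 2 ≤ (Real.sqrt ν) ^ 2 :=
            pow_le_pow_left₀ hm0.le (min_le_right _ _) 2
        _ = ν := Real.sq_sqrt hν.le
    refine ⟨r₀ * min 1 (Real.sqrt ν), mul_pos hr₀ hm0, ?_, ?_⟩
    · calc (r₀ * min 1 (Real.sqrt ν)) ^ 2 = r₀ ^ 2 * (min 1 (Real.sqrt ν)) ^ 2 := mul_pow _ _ _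
        _ ≤ r₀ ^ 2 * ν := mul_le_mul_of_nonneg_left hmsq (sq_nonneg _)
        _ < T * ν := mul_lt_mul_of_pos_right hr₀T hν
        _ = ν * T := mul_comm _ _
    · have hsub := parabolicCylinder_subset_preimage_time_affine (T := T) hν hr₀.le x₀
      refine lt_of_le_of_lt (eLpNorm_mono_measure _ (Measure.restrict_mono hsub le_rfl)) ?_
      rw [hwL, uncurry_smul_stPull_time, eLpNorm_const_smul,
        eLpNorm_top_comp_stAffine_restrict_preimage hβ one_pos]
      exact ENNReal.mul_lt_top enorm_lt_top hbdd
  -- the unit-viscosity statement and the way back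
  obtain ⟨r₁, hr₁, hev⟩ := singular_point_stability_unit hε hPD hKP (mul_pos hν hT) C'
    (fun n => ν⁻¹ • a n) w q (ν⁻¹ • aL) wL qL hw' hwL' hCw hGw hconvw x₀ hregw
  have hm0 : 0 < max 1 (Real.sqrt ν) := lt_of_lt_of_le one_pos (le_max_left _ _)
  refine ⟨r₁ / max 1 (Real.sqrt ν), div_pos hr₁ hm0, ?_⟩
  filter_upwards [hev] with n hn
  have hsub := parabolicCylinder_subset_preimage_time_affine' (T := T) hν hr₁.le x₀
  refine lt_of_le_of_lt (eLpNorm_mono_measure _ (Measure.restrict_mono hsub le_rfl)) ?_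
  rw [uncurry_eq_smul_uncurry_stPull_comp hν.ne' (v n), eLpNorm_const_smul,
    eLpNorm_top_comp_stAffine_restrict_preimage hν one_pos]
  exact ENNReal.mul_lt_top enorm_lt_top hn

end Literature.Analysis.FluidPDE

end
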